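import Summits.QuantumFields.BalabanUV.Beta.GAN24.TableDressingZeroMode
import Summits.QuantumFields.BalabanUV.Beta.GAN24.Push4Iter
import Summits.QuantumFields.BalabanUV.Beta.SpineRecursiveW

/-!
# `BalabanUV.Beta.GAN24.FaceReadTranspose` — binder row G-an2-4 ∕ (CONV-C), W-slot (α-0), ROW (C) AT LEVELS `≥ 1`, RULING R-gan24p1-g40-1's two-index tower:
# **THE PERIOD-`N` FACE READ OF THE SLOT-TRANSPOSED TABLE IS THE BOND-SWAPPED FACE READ** — `FF_N(Yᵀ)(κ,κ′;α,β) = FF_N(Y)(κ′,κ;α,β)` for every `LocStencil₂`,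
# jointly `N`-covariant bi-stencil table `Y`, EVERY period `N` (the masked twin of leaf-02 g67's `FourFaceDressedZeroMode.zmode_transpose_of_cov`); hence under the
# leg-and-bond symmetrisation `LS` the transposed four-face term of the step display merges with the direct one at every period, and the instance for the comb member
# `T2RecAt … j` at every period `N` with `Lc ∣ N` (G-an2-4 OWNER `b2b-balaban-gan24-p1`, gen 40; journal [GAN24P1-G40-INTENT3])

NOT IN PRINT; OUR BOOKKEEPING ([folklore] `tsum` ∕ cell bookkeeping BY NAME over leaf-02 g52's `TableDressingZeroMode` letters (`summable_faceSum`, `face_shift`,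
`tsum_eq_sum_box_tsum`) and `Push4Iter.locStencil₂_swapT`; 0 `def`, 0 cited fact, 0 `def … : Prop`, 0 sorry).  HONEST FRAMING (cell contract, verbatim): «discharging
`BetaPertH` makes Bałaban's UV stability UNCONDITIONAL — a real constructive-QFT result; it is NOT the continuum limit and NOT the Clay problem.»  HONEST DEPENDENCY (verbatim):
«continuum YM on T⁴ ⇐ BetaPertH ∧ nine spine estimates (0/9 proved); BetaPertH ⇐ (D1) ∧ (D4) ∧ CAP+tail; G-an2-4 gates asym, D1 and NE2/3/4.»

WHY.  In the step display of the two-index tower (leaf-02 P40 `zmode_T2RecAt_succ_twoLevel'`; RULING R-gan24p1-g40-1) the transport word carries the four-face reads of BOTH the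
member table `T̃_j` and its slot-transpose `T̃_jᵀ κ u κ′ u′ := T̃_j κ′ u′ κ u`; for the lower term to be ONE multiple of the period-`N` read `Z_N(j)` after `LS`, the transposed
read must be the bond-swapped read.  P39 §4 proved this for the UNMASKED zero mode (`zmode N Yᵀ κ κ′ = zmode N Y κ′ κ`); this file is the FACE-MASKED version at every period —
the same cell-transfer argument (cell decomposition of the free bond, joint covariance to move the cell restriction, shift-invariance of the masked leg series, reversed cell
decomposition), with the face masks riding along because face conditions are coarse-shift invariant (`face_shift`).
* §1 **`faceRead_transpose_of_cov`** (generic `d`, `N`, `Y`): `Σ_{rr∈box N} Σ'_{u′} Σ'_{x,z} [rr_κ, u′_κ′, x_α, z_β faces]·Yᵀ κ (toSite rr) κ′ u′ x z (inl α)(inl β)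
  = Σ_{rr∈box N} Σ'_{u′} Σ'_{x,z} [rr_κ′, u′_κ, x_α, z_β faces]·Y κ′ (toSite rr) κ u′ x z (inl α)(inl β)`.
* §2 **`faceRead_transpose_bondSym`**: hence the bond-symmetrised transposed read equals the bond-symmetrised direct read (the `LS` merge of the two four-face terms).
* §3 **`faceRead_T2RecAt_transpose`**: the instance `Y = T2RecAt d Lc ρ … j` at every period `N` with `Lc ∣ N` (joint `Lc`-covariance `SpineRecursiveW.T2RecAt_translate` iterates to
  `N`; localisation `T2RecAt_loc`) — every `j`, in-block root, `1 ≤ Lc`, generic pins, border ∕ mixed-table letters as in P39.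
Discharges NOTHING of (C)_{≥1} (a kinematic identity); asserts NO value of Bałaban's tables; NEVER «G-an2-4 closed» as (CONV-C); NOT D1, NOT `BetaPertH`, NOT continuum,
NOT Clay.  2026-08-24; no existing file touched.
-/

noncomputable section

open Finset
open scoped BigOperators
open Literature.MathematicalPhysics.QuantumFieldTheory
open Literature.MathematicalPhysics.QuantumFieldTheory.Balaban1983to89
open Literature.MathematicalPhysics.QuantumFieldTheory.Balaban1983to89.Beta
open ExpKernelCalculus (MKer shiftK)
open OneStepResolventKernel (Fib)
open AffineAveraging (Site box toSite)
open BalabanCompositeJets (LocStencil₂)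
open SecondOrderResponse (LocStencilFM)
open Summit.QuantumFields.BalabanUV.Beta.SpineRooted (T2RecAt T2RecAt_loc T2RecAt_translate)
open Summit.QuantumFields.BalabanUV.Beta.GAN24.BiStencilZeroMode (Tab zmode tsum_eq_sum_box_tsum)
open Summit.QuantumFields.BalabanUV.Beta.GAN24.TableDressingZeroMode (summable_triple summable_faceSum summable_ite_of_summable face_shift)
open Summit.QuantumFields.BalabanUV.Beta.GAN24.Push4Iter (locStencil₂_swapT)

namespace Summit.QuantumFields.BalabanUV.Beta.GAN24.FaceReadTranspose

variable {d : ℕ} {N : ℕ}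

/-! ## §1 The face read of the transposed table -/

/-- NOT IN PRINT; OUR BOOKKEEPING.  **`FF_N(Yᵀ)(κ,κ′;α,β) = FF_N(Y)(κ′,κ;α,β)`** for a `LocStencil₂`, jointly `N`-covariant bi-stencil table `Y` and EVERY period `N`: the
period-`N` four-face read (cell-restricted first bond on its exit face, free second bond on its exit face, both legs on exit faces) of the slot-transposed table is the
bond-swapped four-face read of the table.  Cell decomposition of the free bond, joint covariance, shift-invariance of the masked leg series (`face_shift`), reversed cell
decomposition; summability by `summable_faceSum` on `Y` and on `Yᵀ` (`locStencil₂_swapT`). -/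
theorem faceRead_transpose_of_cov [NeZero N] {Y : Tab d} {C δ : ℝ} (hY : LocStencil₂ Y C δ) (hδ : 0 < δ)
    (hcov : ∀ κ u κ' u' t, Y κ (u + (N : ℤ) • t) κ' (u' + (N : ℤ) • t) = shiftK (-((N : ℤ) • t)) (Y κ u κ' u'))
    (κ κ' α β : Fin (d + 1)) :
    ∑ rr ∈ box (d + 1) N, ∑' u' : Site (d + 1), ∑' x : Site (d + 1), ∑' z : Site (d + 1),
        (if toSite rr κ % (N : ℤ) = (N : ℤ) - 1 ∧ u' κ' % (N : ℤ) = (N : ℤ) - 1 ∧ x α % (N : ℤ) = (N : ℤ) - 1 ∧ z β % (N : ℤ) = (N : ℤ) - 1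
          then Y κ' u' κ (toSite rr) x z (Sum.inl α) (Sum.inl β) else 0)
      = ∑ rr ∈ box (d + 1) N, ∑' u' : Site (d + 1), ∑' x : Site (d + 1), ∑' z : Site (d + 1),
        (if toSite rr κ' % (N : ℤ) = (N : ℤ) - 1 ∧ u' κ % (N : ℤ) = (N : ℤ) - 1 ∧ x α % (N : ℤ) = (N : ℤ) - 1 ∧ z β % (N : ℤ) = (N : ℤ) - 1
          then Y κ' (toSite rr) κ u' x z (Sum.inl α) (Sum.inl β) else 0) := by
  have hYT : LocStencil₂ (fun κ₁ u₁ κ₂ u₂ => Y κ₂ u₂ κ₁ u₁) C (δ / 3) := locStencil₂_swapT hY hδ.le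
  have hδ3 : 0 < δ / 3 := by positivity
  -- the masked leg double series as a function of `Y`'s two bonds (`v` = first bond, `s` = second bond), bond masks included
  set G : Site (d + 1) → Site (d + 1) → ℝ := fun v s =>
    if v κ' % (N : ℤ) = (N : ℤ) - 1 ∧ s κ % (N : ℤ) = (N : ℤ) - 1 then
      ∑' x : Site (d + 1), ∑' z : Site (d + 1),
        (if x α % (N : ℤ) = (N : ℤ) - 1 ∧ z β % (N : ℤ) = (N : ℤ) - 1 then Y κ' v κ s x z (Sum.inl α) (Sum.inl β) else 0)
    else 0 with hG
  -- the four-condition summands are `G` read in the two orders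
  have hL : ∀ (rr : Fin (d + 1) → ℕ) (u' : Site (d + 1)),
      (∑' x : Site (d + 1), ∑' z : Site (d + 1),
        (if toSite rr κ % (N : ℤ) = (N : ℤ) - 1 ∧ u' κ' % (N : ℤ) = (N : ℤ) - 1 ∧ x α % (N : ℤ) = (N : ℤ) - 1 ∧ z β % (N : ℤ) = (N : ℤ) - 1
          then Y κ' u' κ (toSite rr) x z (Sum.inl α) (Sum.inl β) else 0)) = G u' (toSite rr) := by
    intro rr u'
    simp only [hG]
    by_cases hA : toSite rr κ % (N : ℤ) = (N : ℤ) - 1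
    · by_cases hB : u' κ' % (N : ℤ) = (N : ℤ) - 1
      · simp only [hA, hB, true_and, and_self, if_true]
      · simp only [hA, hB, false_and, and_false, if_false, tsum_zero]
    · simp only [hA, false_and, if_false, tsum_zero, and_false]
  have hR : ∀ (rr : Fin (d + 1) → ℕ) (u' : Site (d + 1)),
      (∑' x : Site (d + 1), ∑' z : Site (d + 1),
        (if toSite rr κ' % (N : ℤ) = (N : ℤ) - 1 ∧ u' κ % (N : ℤ) = (N : ℤ) - 1 ∧ x α % (N : ℤ) = (N : ℤ) - 1 ∧ z β % (N : ℤ) = (N : ℤ) - 1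
          then Y κ' (toSite rr) κ u' x z (Sum.inl α) (Sum.inl β) else 0)) = G (toSite rr) u' := by
    intro rr u'
    simp only [hG]
    by_cases hA : toSite rr κ' % (N : ℤ) = (N : ℤ) - 1
    · by_cases hB : u' κ % (N : ℤ) = (N : ℤ) - 1
      · simp only [hA, hB, true_and, and_self, if_true]
      · simp only [hA, hB, false_and, and_false, if_false, tsum_zero]
    · simp only [hA, false_and, if_false, tsum_zero]
  simp_rw [hL, hR]
  -- summability of `G` in each bond
  have hGs : ∀ v : Site (d + 1), Summable fun s => G v s := by
    intro v
    have h := summable_faceSum hY hδ κ' v κ (Sum.inl α) (Sum.inl β) (fun x z => x α % (N : ℤ) = (N : ℤ) - 1 ∧ z β % (N : ℤ) = (N : ℤ) - 1)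
    refine (summable_ite_of_summable h (fun s => v κ' % (N : ℤ) = (N : ℤ) - 1 ∧ s κ % (N : ℤ) = (N : ℤ) - 1)).congr fun s => ?_
    simp only [hG]
  have hGv : ∀ s : Site (d + 1), Summable fun v => G v s := by
    intro s
    have h := summable_faceSum hYT hδ3 κ s κ' (Sum.inl α) (Sum.inl β) (fun x z => x α % (N : ℤ) = (N : ℤ) - 1 ∧ z β % (N : ℤ) = (N : ℤ) - 1)
    refine (summable_ite_of_summable h (fun v => v κ' % (N : ℤ) = (N : ℤ) - 1 ∧ s κ % (N : ℤ) = (N : ℤ) - 1)).congr fun v => ?_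
    simp only [hG]
  -- joint covariance of `G`
  have hGcov : ∀ v s t : Site (d + 1), G (v + (N : ℤ) • t) (s + (N : ℤ) • t) = G v s := by
    intro v s t
    simp only [hG, face_shift N v t κ', face_shift N s t κ]
    by_cases hvs : v κ' % (N : ℤ) = (N : ℤ) - 1 ∧ s κ % (N : ℤ) = (N : ℤ) - 1
    · rw [if_pos hvs, if_pos hvs, hcov κ' v κ s t]
      have step : ∀ F : Site (d + 1) → ℝ, ∑' y : Site (d + 1), F (y + (N : ℤ) • t) = ∑' y : Site (d + 1), F y :=
        fun F => (Equiv.addRight ((N : ℤ) • t)).tsum_eq F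
      rw [← step (fun x => ∑' z : Site (d + 1),
        (if x α % (N : ℤ) = (N : ℤ) - 1 ∧ z β % (N : ℤ) = (N : ℤ) - 1 then shiftK (-((N : ℤ) • t)) (Y κ' v κ s) x z (Sum.inl α) (Sum.inl β) else 0))]
      refine tsum_congr fun x => ?_
      rw [← step (fun z => (if (x + (N : ℤ) • t) α % (N : ℤ) = (N : ℤ) - 1 ∧ z β % (N : ℤ) = (N : ℤ) - 1 then
        shiftK (-((N : ℤ) • t)) (Y κ' v κ s) (x + (N : ℤ) • t) z (Sum.inl α) (Sum.inl β) else 0))]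
      refine tsum_congr fun z => ?_
      rw [face_shift N x t α, face_shift N z t β]
      simp only [shiftK, add_neg_cancel_right]
    · rw [if_neg hvs, if_neg hvs]
  -- both sides as double cell sums of `G` (verbatim the unmasked argument)
  have eL : ∀ rr : Fin (d + 1) → ℕ, ∑' v : Site (d + 1), G v (toSite rr)
      = ∑ r₂ ∈ box (d + 1) N, ∑' t : Site (d + 1), G (toSite r₂) (toSite rr + (N : ℤ) • (-t)) := by
    intro rr
    rw [tsum_eq_sum_box_tsum (N := N) (hGv (toSite rr))]
    refine Finset.sum_congr rfl fun r₂ _ => tsum_congr fun t => ?_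
    have h := hGcov (toSite r₂) (toSite rr + (N : ℤ) • (-t)) t
    rw [add_assoc, smul_neg, neg_add_cancel, add_zero, add_comm] at h
    rw [smul_neg]
    exact h
  have eR : ∀ r₂ : Fin (d + 1) → ℕ, ∑' s : Site (d + 1), G (toSite r₂) s
      = ∑ rr ∈ box (d + 1) N, ∑' t : Site (d + 1), G (toSite r₂) (toSite rr + (N : ℤ) • (-t)) := by
    intro r₂
    rw [tsum_eq_sum_box_tsum (N := N) (hGs (toSite r₂))]
    refine Finset.sum_congr rfl fun rr _ => ?_
    rw [← (Equiv.neg (Site (d + 1))).tsum_eq (fun t => G (toSite r₂) (toSite rr + (N : ℤ) • (-t)))]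
    exact tsum_congr fun t => by simp only [Equiv.neg_apply, neg_neg, add_comm]
  rw [Finset.sum_congr rfl fun rr _ => eL rr, Finset.sum_comm]
  exact Finset.sum_congr rfl fun r₂ _ => (eR r₂).symm

/-! ## §2 Under bond symmetrisation the transposed read merges with the direct one -/

/-- NOT IN PRINT; OUR BOOKKEEPING.  **THE `LS` MERGE**: the bond-symmetrised period-`N` face read of `Yᵀ` equals the bond-symmetrised face read of `Y` (§1 twice) — so in a
step display carrying `FF_N(Y) + FF_N(Yᵀ)` the lower term is ONE multiple of the symmetrised `FF_N(Y)` (RULING R-gan24p1-g40-1, `pairFormLS_tower₂`'s single lower term). -/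
theorem faceRead_transpose_bondSym [NeZero N] {Y : Tab d} {C δ : ℝ} (hY : LocStencil₂ Y C δ) (hδ : 0 < δ)
    (hcov : ∀ κ u κ' u' t, Y κ (u + (N : ℤ) • t) κ' (u' + (N : ℤ) • t) = shiftK (-((N : ℤ) • t)) (Y κ u κ' u'))
    (κ κ' α β : Fin (d + 1)) :
    (∑ rr ∈ box (d + 1) N, ∑' u' : Site (d + 1), ∑' x : Site (d + 1), ∑' z : Site (d + 1),
        (if toSite rr κ % (N : ℤ) = (N : ℤ) - 1 ∧ u' κ' % (N : ℤ) = (N : ℤ) - 1 ∧ x α % (N : ℤ) = (N : ℤ) - 1 ∧ z β % (N : ℤ) = (N : ℤ) - 1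
          then Y κ' u' κ (toSite rr) x z (Sum.inl α) (Sum.inl β) else 0))
      + (∑ rr ∈ box (d + 1) N, ∑' u' : Site (d + 1), ∑' x : Site (d + 1), ∑' z : Site (d + 1),
        (if toSite rr κ' % (N : ℤ) = (N : ℤ) - 1 ∧ u' κ % (N : ℤ) = (N : ℤ) - 1 ∧ x α % (N : ℤ) = (N : ℤ) - 1 ∧ z β % (N : ℤ) = (N : ℤ) - 1
          then Y κ u' κ' (toSite rr) x z (Sum.inl α) (Sum.inl β) else 0))
      = (∑ rr ∈ box (d + 1) N, ∑' u' : Site (d + 1), ∑' x : Site (d + 1), ∑' z : Site (d + 1),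
        (if toSite rr κ % (N : ℤ) = (N : ℤ) - 1 ∧ u' κ' % (N : ℤ) = (N : ℤ) - 1 ∧ x α % (N : ℤ) = (N : ℤ) - 1 ∧ z β % (N : ℤ) = (N : ℤ) - 1
          then Y κ (toSite rr) κ' u' x z (Sum.inl α) (Sum.inl β) else 0))
      + (∑ rr ∈ box (d + 1) N, ∑' u' : Site (d + 1), ∑' x : Site (d + 1), ∑' z : Site (d + 1),
        (if toSite rr κ' % (N : ℤ) = (N : ℤ) - 1 ∧ u' κ % (N : ℤ) = (N : ℤ) - 1 ∧ x α % (N : ℤ) = (N : ℤ) - 1 ∧ z β % (N : ℤ) = (N : ℤ) - 1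
          then Y κ' (toSite rr) κ u' x z (Sum.inl α) (Sum.inl β) else 0)) := by
  rw [faceRead_transpose_of_cov hY hδ hcov κ κ' α β, faceRead_transpose_of_cov hY hδ hcov κ' κ α β, add_comm]

/-! ## §3 The instance for the comb member at every period divisible by the block side -/

section Member

variable {Lc : ℕ} [NeZero Lc] {r : Fin (d + 1) → ℕ}

/-- NOT IN PRINT; OUR BOOKKEEPING.  **THE COMB MEMBER's TRANSPOSED FACE READ AT EVERY PERIOD `N = Lc·k`** (every level `j`, in-block root `toSite r`, `1 ≤ Lc`, generic pins;
border ∕ mixed-table letters as in `FourFaceDressedZeroMode` §2): joint `Lc`-covariance (`T2RecAt_translate`) iterates to period `Lc·k`, localisation from `T2RecAt_loc`;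
then §1. -/
theorem faceRead_T2RecAt_transpose (hLc : 1 ≤ Lc) (hr : r ∈ box (d + 1) Lc) (cE cVH cΛ cE₂ cB : ℝ) (T : Fin 4 → Fin 4 → Fin 4 → Fin 4 → ℝ)
    {vh₂S : Tab d} (hB : ∃ C δ : ℝ, 0 < δ ∧ LocStencil₂ vh₂S C δ)
    (hBt : ∀ (κ : Fin (d + 1)) (u : Site (d + 1)) (κ' : Fin (d + 1)) (u' t : Site (d + 1)),
      vh₂S κ (u + (Lc : ℤ) • t) κ' (u' + (Lc : ℤ) • t) = shiftK (-((Lc : ℤ) • t)) (vh₂S κ u κ' u'))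
    {mixFF : Fin (d + 1) → Site (d + 1) → Fin (d + 1) → Site (d + 1) → MKer (d + 1) (Fib d)} (hmix : ∃ C δ : ℝ, 0 < δ ∧ LocStencilFM Lc mixFF C δ)
    (hmixt : ∀ (κ : Fin (d + 1)) (u : Site (d + 1)) (μ : Fin (d + 1)) (w t : Site (d + 1)), mixFF κ (u + (Lc : ℤ) • t) μ (w + t) = shiftK (-((Lc : ℤ) • t)) (mixFF κ u μ w))
    (k : ℕ) [NeZero (Lc * k)] (j : ℕ) (κ κ' α β : Fin (d + 1)) :
    ∑ rr ∈ box (d + 1) (Lc * k), ∑' u' : Site (d + 1), ∑' x : Site (d + 1), ∑' z : Site (d + 1),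
        (if toSite rr κ % ((Lc * k : ℕ) : ℤ) = ((Lc * k : ℕ) : ℤ) - 1 ∧ u' κ' % ((Lc * k : ℕ) : ℤ) = ((Lc * k : ℕ) : ℤ) - 1 ∧
            x α % ((Lc * k : ℕ) : ℤ) = ((Lc * k : ℕ) : ℤ) - 1 ∧ z β % ((Lc * k : ℕ) : ℤ) = ((Lc * k : ℕ) : ℤ) - 1
          then T2RecAt d Lc (toSite r) cE cVH cΛ cE₂ cB T vh₂S mixFF j κ' u' κ (toSite rr) x z (Sum.inl α) (Sum.inl β) else 0)
      = ∑ rr ∈ box (d + 1) (Lc * k), ∑' u' : Site (d + 1), ∑' x : Site (d + 1), ∑' z : Site (d + 1),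
        (if toSite rr κ' % ((Lc * k : ℕ) : ℤ) = ((Lc * k : ℕ) : ℤ) - 1 ∧ u' κ % ((Lc * k : ℕ) : ℤ) = ((Lc * k : ℕ) : ℤ) - 1 ∧
            x α % ((Lc * k : ℕ) : ℤ) = ((Lc * k : ℕ) : ℤ) - 1 ∧ z β % ((Lc * k : ℕ) : ℤ) = ((Lc * k : ℕ) : ℤ) - 1
          then T2RecAt d Lc (toSite r) cE cVH cΛ cE₂ cB T vh₂S mixFF j κ' (toSite rr) κ u' x z (Sum.inl α) (Sum.inl β) else 0) := by
  obtain ⟨C₂, δ₂, hδ₂, hT⟩ := T2RecAt_loc cE cVH cΛ cE₂ cB T vh₂S mixFF hLc hr hB hmix j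
  have hcovN : ∀ (κ₁ : Fin (d + 1)) (u : Site (d + 1)) (κ₂ : Fin (d + 1)) (u' t : Site (d + 1)),
      T2RecAt d Lc (toSite r) cE cVH cΛ cE₂ cB T vh₂S mixFF j κ₁ (u + ((Lc * k : ℕ) : ℤ) • t) κ₂ (u' + ((Lc * k : ℕ) : ℤ) • t)
        = shiftK (-(((Lc * k : ℕ) : ℤ) • t)) (T2RecAt d Lc (toSite r) cE cVH cΛ cE₂ cB T vh₂S mixFF j κ₁ u κ₂ u') := by
    intro κ₁ u κ₂ u' t
    have e : ((Lc * k : ℕ) : ℤ) • t = (Lc : ℤ) • ((k : ℤ) • t) := by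
      rw [smul_smul]; push_cast; ring_nf
    rw [e]
    exact T2RecAt_translate (ρ := toSite r) cE cVH cΛ cE₂ cB T vh₂S mixFF hLc hBt hmixt j κ₁ u κ₂ u' ((k : ℤ) • t)
  exact faceRead_transpose_of_cov hT hδ₂ hcovN κ κ' α β

end Member

end Summit.QuantumFields.BalabanUV.Beta.GAN24.FaceReadTranspose
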